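import Literature.MathematicalPhysics.QuantumLattice.TorusSectorGibbsEntropyRowPressureFloors
import Literature.MathematicalPhysics.QuantumLattice.GibbsPressureTemperature
import HarnessLib

/-!
# The β-STAIRCASE in the thermodynamic limit: pressure floors (and ceilings) from certified thermal energy
# caps (floors) along a temperature grid

Topic `MathematicalPhysics/QuantumLattice`. `GibbsPressureTemperature.lean` proves the finite-volume
staircases (convexity of `β ↦ log Z_β` with slope `−E_β`): for a grid `b₀ ≤ b₁ ≤ … ≤ b_N` and energies
`E_{b_i} ≤ E_i`, `log Z_{b_N} ≥ log Z_{b₀} − Σ_i (b_{i+1} − b_i) E_i` (`log_partitionFn_sub_sum_mul_le`), and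
dually `log Z_{b_N} ≤ log Z_{b₀} − Σ_i (b_{i+1} − b_i) E′_{i+1}` from floors `E′_{i+1} ≤ E_{b_{i+1}}`
(`log_partitionFn_le_sub_sum_mul`). Here they are passed to the canonical sector Gibbs states of
`hubbardTorusTT' L t t' U` in the thermodynamic limit: a thermal energy CAP `e(ω) ≤ e⁺_i` certified for EVERY
torus limit at `b_i` is a `limsup` bound on the finite-volume canonical energies
(`eventually_re_sectorGibbsAvg_le_of_forall_torusLimit`, `TorusLimitOfMixturesLimsup.lean`), so

* `eventually_energy_sectorGibbs_le_of_forall_torusLimit` — `∀ ε > 0, ∀ᶠ L, E_β(L) ≤ (e⁺ + ε) L²` from a cap on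
  every torus limit at `β`; `eventually_le_energy_sectorGibbs_of_forall_torusLimit` — the floor version;
* `eventually_pressureFloor_staircase` — a pressure floor `W₀` at `b₀` along `Ls` and caps `e⁺_i` at `b_i`
  (`i < N`) give the pressure floor `W₀ − Σ_i (b_{i+1} − b_i) e⁺_i` at `b_N` along `Ls`, in the `hW` shape
  consumed by the entropy rows (`…_of_pressureFloor`) and the chord / axis theorems (`HubbardThermalAxisWindow`);
* `eventually_pressureCeiling_staircase` — a pressure ceiling `u₀` at `b₀` and floors `e⁻_{i+1}` at `b_{i+1}`
  give the ceiling `u₀ − Σ_i (b_{i+1} − b_i) e⁻_{i+1}` at `b_N` (the `hu` shape: hot anchors for the chords).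

This is the «β-staircase / thermodynamic-integration bootstrap» of the free-energy input `f⁺ = −W/β`
(`π(β) = π(b₀) − ∫ e dβ′`, `e` antitone): every certified cap along the temperature axis improves the
entropy-bearing `f⁺` at colder temperatures, which tightens the caps there, and so on down the axis.
Everything is PROVED; no definition, no named fact.

References: Gustafson–Sigal 2011 §18.3 (convexity of the pressure) [GustafsonSigal2003]; Israel 1979 §I.3
eq. (26), Lemma II.3.1 [Israel1979]; Bratteli–Robinson II Thm. 6.2.40 [BratteliRobinsonII1997].
-/

noncomputable section

namespace Literature.MathematicalPhysics.QuantumLattice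

open Matrix Finset HubbardWave0 ThermodynamicLimit Literature.Probability.LatticeModels
open _root_.Filter
open scoped _root_.Topology ComplexOrder BigOperators

/-! ### §1 Finite-volume canonical energies from torus-limit caps and floors -/

/-- **A thermal energy cap on every torus limit is a `limsup` bound on the finite-volume canonical energies.**
`0 ≤ n ≤ 2`; if `e_{Φ(t,t',U)}(ω) ≤ e⁺` for every torus limit `ω` of the canonical sector Gibbs states at `β`
(along every `Ls → ∞`), then for every `ε > 0`, eventually in `L`,
`Re⟨H_L|_K⟩_β ≤ (e⁺ + ε)·L²`. [cite: Israel1979, §I.3 eq. (26)] -/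
theorem eventually_energy_sectorGibbs_le_of_forall_torusLimit (t t' U : ℝ) {n : ℝ} (hn0 : 0 ≤ n)
    (hn2 : n ≤ 2) (β : ℝ) {eup : ℝ}
    (hcap : ∀ (ω : InfVolFermionState 2) (Ls : ℕ → ℕ), Tendsto Ls atTop atTop →
      ω.IsTorusLimitOfMixture (sectorGibbsCount n) (fun L => sectorGibbsWeightTT' β t t' U n L)
        (fun L => sectorGibbsVectorTT' t t' U n L) Ls →
      ω.meanEnergy (hubbardTTPrimeFermionInteraction t t' U) 1 ≤ eup)
    {ε : ℝ} (hε : 0 < ε) :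
    ∀ᶠ L : ℕ in atTop, (gibbsState β (sectorHamiltonianTT' t t' U n L) (sectorHamiltonianTT' t t' U n L)).re ≤
      (eup + ε) * (L : ℝ) ^ 2 := by
  have h := eventually_re_sectorGibbsAvg_le_of_forall_torusLimit t t' U hn0 hn2 β
    (thicken ({0} : Finset (Site 2)) 1) ((hubbardTTPrimeFermionInteraction t t' U).meanEnergyObs 1) (b := eup)
    (fun ω Ls hLs hω => hcap ω Ls hLs hω) hε
  filter_upwards [h, eventually_ge_atTop 3] with L hL hL3
  haveI : NeZero L := ⟨by omega⟩
  have hL2 : (0 : ℝ) < (L : ℝ) ^ 2 := by positivity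
  have hid : (∑ i, (sectorGibbsWeightTT' β t t' U n L i : ℂ) *
        torusAvgExpect L (thicken ({0} : Finset (Site 2)) 1)
          ((hubbardTTPrimeFermionInteraction t t' U).meanEnergyObs 1) (sectorGibbsVectorTT' t t' U n L i)).re =
      (gibbsState β (sectorHamiltonianTT' t t' U n L) (sectorHamiltonianTT' t t' U n L)).re / (L : ℝ) ^ 2 := by
    rw [← re_trace_sectorGibbsDensityTT'_mul_hubbardTorusTT' L, re_trace_sectorGibbsDensityTT'_mul, Complex.re_sum,
      Finset.sum_div]
    refine Finset.sum_congr rfl fun i _ => ?_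
    rw [torusAvgExpect_hubbardTTPrime_meanEnergyObs t t' U hL3, ← Complex.ofReal_natCast, ← Complex.ofReal_pow,
      Complex.re_ofReal_mul, Complex.div_ofReal_re]
    ring
  rw [hid, div_le_iff₀ hL2] at hL
  exact hL

/-- **A thermal energy floor on every torus limit is a `liminf` bound on the finite-volume canonical energies**
(mirror form): `e⁻ ≤ e(ω)` for every torus limit at `β` ⇒ `∀ ε > 0`, eventually `(e⁻ − ε)·L² ≤ Re⟨H_L|_K⟩_β`.
[cite: Israel1979, §I.3 eq. (26)] -/
theorem eventually_le_energy_sectorGibbs_of_forall_torusLimit (t t' U : ℝ) {n : ℝ} (hn0 : 0 ≤ n)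
    (hn2 : n ≤ 2) (β : ℝ) {elo : ℝ}
    (hfloor : ∀ (ω : InfVolFermionState 2) (Ls : ℕ → ℕ), Tendsto Ls atTop atTop →
      ω.IsTorusLimitOfMixture (sectorGibbsCount n) (fun L => sectorGibbsWeightTT' β t t' U n L)
        (fun L => sectorGibbsVectorTT' t t' U n L) Ls →
      elo ≤ ω.meanEnergy (hubbardTTPrimeFermionInteraction t t' U) 1)
    {ε : ℝ} (hε : 0 < ε) :
    ∀ᶠ L : ℕ in atTop, (elo - ε) * (L : ℝ) ^ 2 ≤
      (gibbsState β (sectorHamiltonianTT' t t' U n L) (sectorHamiltonianTT' t t' U n L)).re := by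
  have h := eventually_re_sectorGibbsAvg_ge_of_forall_torusLimit t t' U hn0 hn2 β
    (thicken ({0} : Finset (Site 2)) 1) ((hubbardTTPrimeFermionInteraction t t' U).meanEnergyObs 1) (b := elo)
    (fun ω Ls hLs hω => hfloor ω Ls hLs hω) hε
  filter_upwards [h, eventually_ge_atTop 3] with L hL hL3
  haveI : NeZero L := ⟨by omega⟩
  have hL2 : (0 : ℝ) < (L : ℝ) ^ 2 := by positivity
  have hid : (∑ i, (sectorGibbsWeightTT' β t t' U n L i : ℂ) *
        torusAvgExpect L (thicken ({0} : Finset (Site 2)) 1)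
          ((hubbardTTPrimeFermionInteraction t t' U).meanEnergyObs 1) (sectorGibbsVectorTT' t t' U n L i)).re =
      (gibbsState β (sectorHamiltonianTT' t t' U n L) (sectorHamiltonianTT' t t' U n L)).re / (L : ℝ) ^ 2 := by
    rw [← re_trace_sectorGibbsDensityTT'_mul_hubbardTorusTT' L, re_trace_sectorGibbsDensityTT'_mul, Complex.re_sum,
      Finset.sum_div]
    refine Finset.sum_congr rfl fun i _ => ?_
    rw [torusAvgExpect_hubbardTTPrime_meanEnergyObs t t' U hL3, ← Complex.ofReal_natCast, ← Complex.ofReal_pow,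
      Complex.re_ofReal_mul, Complex.div_ofReal_re]
    ring
  rw [hid, le_div_iff₀ hL2] at hL
  exact hL

/-! ### §2 The staircases along the tori defining a torus limit -/

/-- **β-staircase pressure FLOOR in the thermodynamic limit.** `0 ≤ n ≤ 2`, `Ls → ∞`, a grid `b : ℕ → ℝ`
monotone with `b 0 ≥ 0`, `N` steps; a pressure floor at the anchor `b 0` along `Ls`
(`∀ ε > 0, ∀ᶠ j, (W₀ − ε)(Ls j)² ≤ log Re Z_{b 0}(Ls j)`) and, for every `i < N`, an energy CAP `e⁺_i` valid for
every torus limit of the canonical sector Gibbs states at `b i`. Then along `Ls`, for every `ε > 0`, eventually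
`(W₀ − Σ_{i<N} (b_{i+1} − b_i)·e⁺_i − ε)(Ls j)² ≤ log Re Z_{b N}(Ls j)` — the `hW` pressure-floor hypothesis at
`β = b N` (Riemann-sum form of `π(β) = π(b₀) − ∫ e`, `e` antitone). [cite: GustafsonSigal2003, §18.3]
[cite: Israel1979, Lemma II.3.1] -/
theorem eventually_pressureFloor_staircase (t t' U : ℝ) {n : ℝ} (hn0 : 0 ≤ n) (hn2 : n ≤ 2)
    {Ls : ℕ → ℕ} (hLs : Tendsto Ls atTop atTop) {b : ℕ → ℝ} (hb0 : 0 ≤ b 0) (hb : Monotone b) (N : ℕ)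
    {ecap : ℕ → ℝ}
    (hcap : ∀ i < N, ∀ (ω : InfVolFermionState 2) (Ls' : ℕ → ℕ), Tendsto Ls' atTop atTop →
      ω.IsTorusLimitOfMixture (sectorGibbsCount n) (fun L => sectorGibbsWeightTT' (b i) t t' U n L)
        (fun L => sectorGibbsVectorTT' t t' U n L) Ls' →
      ω.meanEnergy (hubbardTTPrimeFermionInteraction t t' U) 1 ≤ ecap i)
    {W₀ : ℝ}
    (hW₀ : ∀ ε : ℝ, 0 < ε → ∀ᶠ j in atTop,
      (W₀ - ε) * (Ls j : ℝ) ^ 2 ≤ Real.log (partitionFn (b 0) (sectorHamiltonianTT' t t' U n (Ls j))).re)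
    {ε : ℝ} (hε : 0 < ε) :
    ∀ᶠ j in atTop, (W₀ - ∑ i ∈ Finset.range N, (b (i + 1) - b i) * ecap i - ε) * (Ls j : ℝ) ^ 2 ≤
      Real.log (partitionFn (b N) (sectorHamiltonianTT' t t' U n (Ls j))).re := by
  -- the total β-length of the grid and the per-step slack
  set D : ℝ := ∑ i ∈ Finset.range N, (b (i + 1) - b i) with hD
  have hD0 : 0 ≤ D := Finset.sum_nonneg fun i _ => sub_nonneg.2 (hb (Nat.le_succ i))
  set ε₂ : ℝ := ε / (2 * (D + 1)) with hε₂
  have hε₂pos : 0 < ε₂ := by positivity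
  -- eventually (in `L`) every cap holds at finite volume up to `ε₂`
  have hcaps : ∀ᶠ L : ℕ in atTop, ∀ i ∈ Finset.range N,
      (gibbsState (b i) (sectorHamiltonianTT' t t' U n L) (sectorHamiltonianTT' t t' U n L)).re ≤
        (ecap i + ε₂) * (L : ℝ) ^ 2 := by
    rw [eventually_all_finset]
    intro i hi
    exact eventually_energy_sectorGibbs_le_of_forall_torusLimit t t' U hn0 hn2 (b i)
      (hcap i (Finset.mem_range.1 hi)) hε₂pos
  filter_upwards [hLs.eventually hcaps, hW₀ (ε / 2) (by linarith), hLs.eventually_ge_atTop 1] with j hj hWj hj1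
  haveI : NeZero (Ls j) := ⟨by omega⟩
  haveI := nonempty_szConfig hn0 hn2 (Ls j)
  have hL2 : (0 : ℝ) ≤ (Ls j : ℝ) ^ 2 := by positivity
  -- the finite-volume staircase at `L = Ls j`
  have hst := log_partitionFn_sub_sum_mul_le (isHermitian_sectorHamiltonianTT' t t' U n (Ls j)) hb0 hb N
    (E := fun i => (ecap i + ε₂) * (Ls j : ℝ) ^ 2) (fun i hi => hj i (Finset.mem_range.2 hi))
  -- bookkeeping: `Σ Δ_i (e⁺_i + ε₂) L² = (Σ Δ_i e⁺_i) L² + ε₂ D L²` and `ε₂ D ≤ ε/2`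
  have hsum : ∑ i ∈ Finset.range N, (b (i + 1) - b i) * ((ecap i + ε₂) * (Ls j : ℝ) ^ 2) =
      (∑ i ∈ Finset.range N, (b (i + 1) - b i) * ecap i) * (Ls j : ℝ) ^ 2 + ε₂ * D * (Ls j : ℝ) ^ 2 := by
    rw [hD, Finset.sum_mul, Finset.mul_sum, Finset.sum_mul, ← Finset.sum_add_distrib]
    refine Finset.sum_congr rfl fun i _ => ?_
    ring
  have hslack : ε₂ * D ≤ ε / 2 := by
    rw [hε₂, div_mul_eq_mul_div, div_le_iff₀ (by positivity)]
    nlinarith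
  rw [hsum] at hst
  have h3 : ε₂ * D * (Ls j : ℝ) ^ 2 ≤ ε / 2 * (Ls j : ℝ) ^ 2 := mul_le_mul_of_nonneg_right hslack hL2
  nlinarith

/-- **β-staircase pressure CEILING in the thermodynamic limit** (dual form). A pressure ceiling at the
anchor `b 0` along `Ls` (`∀ ε > 0, ∀ᶠ j, log Re Z_{b 0}(Ls j) ≤ (u₀ + ε)(Ls j)²`; at `b 0 = 0` this is the
sector entropy `log dim`) and, for every `i < N`, an energy FLOOR `e⁻_{i+1} ≤ e(ω)` for every torus limit at
`b (i+1)`. Then along `Ls`, for every `ε > 0`, eventually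
`log Re Z_{b N}(Ls j) ≤ (u₀ − Σ_{i<N} (b_{i+1} − b_i)·e⁻_{i+1} + ε)(Ls j)²` — the `hu` pressure-ceiling hypothesis
(hot anchors of the chords). [cite: GustafsonSigal2003, §18.3] [cite: Israel1979, Lemma II.3.1] -/
theorem eventually_pressureCeiling_staircase (t t' U : ℝ) {n : ℝ} (hn0 : 0 ≤ n) (hn2 : n ≤ 2)
    {Ls : ℕ → ℕ} (hLs : Tendsto Ls atTop atTop) {b : ℕ → ℝ} (hb0 : 0 ≤ b 0) (hb : Monotone b) (N : ℕ)
    {efl : ℕ → ℝ}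
    (hfloor : ∀ i < N, ∀ (ω : InfVolFermionState 2) (Ls' : ℕ → ℕ), Tendsto Ls' atTop atTop →
      ω.IsTorusLimitOfMixture (sectorGibbsCount n) (fun L => sectorGibbsWeightTT' (b (i + 1)) t t' U n L)
        (fun L => sectorGibbsVectorTT' t t' U n L) Ls' →
      efl (i + 1) ≤ ω.meanEnergy (hubbardTTPrimeFermionInteraction t t' U) 1)
    {u₀ : ℝ}
    (hu₀ : ∀ ε : ℝ, 0 < ε → ∀ᶠ j in atTop,
      Real.log (partitionFn (b 0) (sectorHamiltonianTT' t t' U n (Ls j))).re ≤ (u₀ + ε) * (Ls j : ℝ) ^ 2)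
    {ε : ℝ} (hε : 0 < ε) :
    ∀ᶠ j in atTop, Real.log (partitionFn (b N) (sectorHamiltonianTT' t t' U n (Ls j))).re ≤
      (u₀ - ∑ i ∈ Finset.range N, (b (i + 1) - b i) * efl (i + 1) + ε) * (Ls j : ℝ) ^ 2 := by
  set D : ℝ := ∑ i ∈ Finset.range N, (b (i + 1) - b i) with hD
  have hD0 : 0 ≤ D := Finset.sum_nonneg fun i _ => sub_nonneg.2 (hb (Nat.le_succ i))
  set ε₂ : ℝ := ε / (2 * (D + 1)) with hε₂
  have hε₂pos : 0 < ε₂ := by positivity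
  have hfloors : ∀ᶠ L : ℕ in atTop, ∀ i ∈ Finset.range N,
      (efl (i + 1) - ε₂) * (L : ℝ) ^ 2 ≤
        (gibbsState (b (i + 1)) (sectorHamiltonianTT' t t' U n L) (sectorHamiltonianTT' t t' U n L)).re := by
    rw [eventually_all_finset]
    intro i hi
    exact eventually_le_energy_sectorGibbs_of_forall_torusLimit t t' U hn0 hn2 (b (i + 1))
      (hfloor i (Finset.mem_range.1 hi)) hε₂pos
  filter_upwards [hLs.eventually hfloors, hu₀ (ε / 2) (by linarith), hLs.eventually_ge_atTop 1] with j hj huj hj1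
  haveI : NeZero (Ls j) := ⟨by omega⟩
  haveI := nonempty_szConfig hn0 hn2 (Ls j)
  have hL2 : (0 : ℝ) ≤ (Ls j : ℝ) ^ 2 := by positivity
  have hst := log_partitionFn_le_sub_sum_mul (isHermitian_sectorHamiltonianTT' t t' U n (Ls j)) hb0 hb N
    (E' := fun i => (efl i - ε₂) * (Ls j : ℝ) ^ 2) (fun i hi => hj i (Finset.mem_range.2 hi))
  have hsum : ∑ i ∈ Finset.range N, (b (i + 1) - b i) * ((efl (i + 1) - ε₂) * (Ls j : ℝ) ^ 2) =
      (∑ i ∈ Finset.range N, (b (i + 1) - b i) * efl (i + 1)) * (Ls j : ℝ) ^ 2 - ε₂ * D * (Ls j : ℝ) ^ 2 := by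
    rw [hD, Finset.sum_mul, Finset.mul_sum, Finset.sum_mul, ← Finset.sum_sub_distrib]
    refine Finset.sum_congr rfl fun i _ => ?_
    ring
  have hslack : ε₂ * D ≤ ε / 2 := by
    rw [hε₂, div_mul_eq_mul_div, div_le_iff₀ (by positivity)]
    nlinarith
  rw [hsum] at hst
  have h3 : ε₂ * D * (Ls j : ℝ) ^ 2 ≤ ε / 2 * (Ls j : ℝ) ^ 2 := mul_le_mul_of_nonneg_right hslack hL2
  nlinarith

/-! ### §3 Caps certified only along a family of tori: the staircase relative to the defining sequence

Pressure floors from box tilings, and hence the energy caps derived from them by the entropy rows, may hold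
only along box-compatible tori `Ls`. The staircase survives in that setting: it suffices that the caps hold for
every torus limit along every SUBSEQUENCE of `Ls` (compactness is applied inside `Ls`). -/

/-- **Caps along subsequences of `Ls` bound the canonical energies along `Ls`.** `0 ≤ n ≤ 2`, `Ls → ∞`; if
`e_Φ(ω) ≤ e⁺` for every torus limit `ω` of the canonical sector Gibbs states at `β` along every subsequence
`Ls ∘ φ`, then for every `ε > 0`, eventually in `j`, `Re⟨H_{Ls j}|_K⟩_β ≤ (e⁺ + ε)·(Ls j)²`.
[cite: Israel1979, §I.3 eq. (26)] [cite: BratteliRobinsonII1997, Thm. 6.2.40] -/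
theorem eventually_energy_sectorGibbs_le_of_forall_torusLimit_subseq (t t' U : ℝ) {n : ℝ} (hn0 : 0 ≤ n)
    (hn2 : n ≤ 2) (β : ℝ) {Ls : ℕ → ℕ} (hLs : Tendsto Ls atTop atTop) {eup : ℝ}
    (hcap : ∀ (ω : InfVolFermionState 2) (φ : ℕ → ℕ), StrictMono φ →
      ω.IsTorusLimitOfMixture (sectorGibbsCount n) (fun L => sectorGibbsWeightTT' β t t' U n L)
        (fun L => sectorGibbsVectorTT' t t' U n L) (Ls ∘ φ) →
      ω.meanEnergy (hubbardTTPrimeFermionInteraction t t' U) 1 ≤ eup)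
    {ε : ℝ} (hε : 0 < ε) :
    ∀ᶠ j : ℕ in atTop, (gibbsState β (sectorHamiltonianTT' t t' U n (Ls j)) (sectorHamiltonianTT' t t' U n (Ls j))).re ≤
      (eup + ε) * (Ls j : ℝ) ^ 2 := by
  by_contra hnot
  have hfreq : ∃ᶠ j in atTop, ¬ ((gibbsState β (sectorHamiltonianTT' t t' U n (Ls j))
      (sectorHamiltonianTT' t t' U n (Ls j))).re ≤ (eup + ε) * (Ls j : ℝ) ^ 2) ∧ 1 ≤ Ls j :=
    (Filter.not_eventually.1 hnot).and_eventually (hLs.eventually_ge_atTop 1)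
  obtain ⟨φ₁, hφ₁, hbad⟩ := extraction_of_frequently_atTop hfreq
  have hL1 : Tendsto (Ls ∘ φ₁) atTop atTop := hLs.comp hφ₁.tendsto_atTop
  obtain ⟨φ₂, hφ₂, ω, hω⟩ := exists_isTorusLimitOfMixture_sectorGibbs_subseq t t' U hn0 hn2 β hL1
  have hL2 : Tendsto ((Ls ∘ φ₁) ∘ φ₂) atTop atTop := hL1.comp hφ₂.tendsto_atTop
  have hcapω : ω.meanEnergy (hubbardTTPrimeFermionInteraction t t' U) 1 ≤ eup :=
    hcap ω (φ₁ ∘ φ₂) (hφ₁.comp hφ₂) hω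
  have hconv := hω.tendsto_meanEnergy_hubbardTTPrime t t' U hL2
  -- along the extracted subsequence the normalised energies stay above `e⁺ + ε`
  have hge : ∀ k, eup + ε ≤ ∑ i, sectorGibbsWeightTT' β t t' U n (((Ls ∘ φ₁) ∘ φ₂) k) i *
      ((QuantumLattice.expect (hubbardTorusTT' (((Ls ∘ φ₁) ∘ φ₂) k) t t' U)
        (sectorGibbsVectorTT' t t' U n (((Ls ∘ φ₁) ∘ φ₂) k) i)).re / ((((Ls ∘ φ₁) ∘ φ₂) k : ℕ) : ℝ) ^ 2) := by
    intro k
    set L := ((Ls ∘ φ₁) ∘ φ₂) k with hL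
    have hk := lt_of_not_ge (hbad (φ₂ k)).1
    have hL1' : 1 ≤ L := (hbad (φ₂ k)).2
    change (eup + ε) * (L : ℝ) ^ 2 <
      (gibbsState β (sectorHamiltonianTT' t t' U n L) (sectorHamiltonianTT' t t' U n L)).re at hk
    haveI : NeZero L := ⟨by omega⟩
    have hLpos : (0 : ℝ) < (L : ℝ) ^ 2 := by
      have : (0 : ℝ) < (L : ℝ) := by exact_mod_cast hL1'
      positivity
    have hid : ∑ i, sectorGibbsWeightTT' β t t' U n L i *
        ((QuantumLattice.expect (hubbardTorusTT' L t t' U) (sectorGibbsVectorTT' t t' U n L i)).re / (L : ℝ) ^ 2) =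
        (gibbsState β (sectorHamiltonianTT' t t' U n L) (sectorHamiltonianTT' t t' U n L)).re / (L : ℝ) ^ 2 := by
      rw [← re_trace_sectorGibbsDensityTT'_mul_hubbardTorusTT' L, re_trace_sectorGibbsDensityTT'_mul, Finset.sum_div]
      refine Finset.sum_congr rfl fun i _ => ?_
      ring
    rw [hid, le_div_iff₀ hLpos]
    exact hk.le
  have hle : eup + ε ≤ ω.meanEnergy (hubbardTTPrimeFermionInteraction t t' U) 1 := ge_of_tendsto' hconv hge
  linarith

/-- **β-staircase pressure FLOOR relative to the defining tori.** As `eventually_pressureFloor_staircase`,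
but the caps `e⁺_i` need only hold for torus limits at `b i` along SUBSEQUENCES of the given `Ls` (e.g. caps
derived from pressure floors certified on box-compatible tori only). Conclusion unchanged: for every `ε > 0`,
eventually `(W₀ − Σ_{i<N} (b_{i+1} − b_i)·e⁺_i − ε)(Ls j)² ≤ log Re Z_{b N}(Ls j)`.
[cite: GustafsonSigal2003, §18.3] [cite: Israel1979, Lemma II.3.1] -/
theorem eventually_pressureFloor_staircase_subseq (t t' U : ℝ) {n : ℝ} (hn0 : 0 ≤ n) (hn2 : n ≤ 2)
    {Ls : ℕ → ℕ} (hLs : Tendsto Ls atTop atTop) {b : ℕ → ℝ} (hb0 : 0 ≤ b 0) (hb : Monotone b) (N : ℕ)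
    {ecap : ℕ → ℝ}
    (hcap : ∀ i < N, ∀ (ω : InfVolFermionState 2) (φ : ℕ → ℕ), StrictMono φ →
      ω.IsTorusLimitOfMixture (sectorGibbsCount n) (fun L => sectorGibbsWeightTT' (b i) t t' U n L)
        (fun L => sectorGibbsVectorTT' t t' U n L) (Ls ∘ φ) →
      ω.meanEnergy (hubbardTTPrimeFermionInteraction t t' U) 1 ≤ ecap i)
    {W₀ : ℝ}
    (hW₀ : ∀ ε : ℝ, 0 < ε → ∀ᶠ j in atTop,
      (W₀ - ε) * (Ls j : ℝ) ^ 2 ≤ Real.log (partitionFn (b 0) (sectorHamiltonianTT' t t' U n (Ls j))).re)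
    {ε : ℝ} (hε : 0 < ε) :
    ∀ᶠ j in atTop, (W₀ - ∑ i ∈ Finset.range N, (b (i + 1) - b i) * ecap i - ε) * (Ls j : ℝ) ^ 2 ≤
      Real.log (partitionFn (b N) (sectorHamiltonianTT' t t' U n (Ls j))).re := by
  set D : ℝ := ∑ i ∈ Finset.range N, (b (i + 1) - b i) with hD
  have hD0 : 0 ≤ D := Finset.sum_nonneg fun i _ => sub_nonneg.2 (hb (Nat.le_succ i))
  set ε₂ : ℝ := ε / (2 * (D + 1)) with hε₂
  have hε₂pos : 0 < ε₂ := by positivity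
  have hcaps : ∀ᶠ j : ℕ in atTop, ∀ i ∈ Finset.range N,
      (gibbsState (b i) (sectorHamiltonianTT' t t' U n (Ls j)) (sectorHamiltonianTT' t t' U n (Ls j))).re ≤
        (ecap i + ε₂) * (Ls j : ℝ) ^ 2 := by
    rw [eventually_all_finset]
    intro i hi
    exact eventually_energy_sectorGibbs_le_of_forall_torusLimit_subseq t t' U hn0 hn2 (b i) hLs
      (hcap i (Finset.mem_range.1 hi)) hε₂pos
  filter_upwards [hcaps, hW₀ (ε / 2) (by linarith), hLs.eventually_ge_atTop 1] with j hj hWj hj1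
  haveI : NeZero (Ls j) := ⟨by omega⟩
  haveI := nonempty_szConfig hn0 hn2 (Ls j)
  have hL2 : (0 : ℝ) ≤ (Ls j : ℝ) ^ 2 := by positivity
  have hst := log_partitionFn_sub_sum_mul_le (isHermitian_sectorHamiltonianTT' t t' U n (Ls j)) hb0 hb N
    (E := fun i => (ecap i + ε₂) * (Ls j : ℝ) ^ 2) (fun i hi => hj i (Finset.mem_range.2 hi))
  have hsum : ∑ i ∈ Finset.range N, (b (i + 1) - b i) * ((ecap i + ε₂) * (Ls j : ℝ) ^ 2) =
      (∑ i ∈ Finset.range N, (b (i + 1) - b i) * ecap i) * (Ls j : ℝ) ^ 2 + ε₂ * D * (Ls j : ℝ) ^ 2 := by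
    rw [hD, Finset.sum_mul, Finset.mul_sum, Finset.sum_mul, ← Finset.sum_add_distrib]
    refine Finset.sum_congr rfl fun i _ => ?_
    ring
  have hslack : ε₂ * D ≤ ε / 2 := by
    rw [hε₂, div_mul_eq_mul_div, div_le_iff₀ (by positivity)]
    nlinarith
  rw [hsum] at hst
  have h3 : ε₂ * D * (Ls j : ℝ) ^ 2 ≤ ε / 2 * (Ls j : ℝ) ^ 2 := mul_le_mul_of_nonneg_right hslack hL2
  nlinarith

end Literature.MathematicalPhysics.QuantumLattice

end
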